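import Summits.Ventures.QEC.CircuitDistance.ETowerZeroMini345XZ0
import Summits.Ventures.QEC.CircuitDistance.ETowerZeroMini345XZ1
import Summits.Ventures.QEC.CircuitDistance.ETowerZeroMini345XU
import Summits.Ventures.QEC.CircuitDistance.ETowerSound
import Summits.Ventures.QEC.CircuitDistance.ETowerZero345SoundX
import HarnessLib

/-!
# #345 X tower (W = 10): THE LEVEL-C ZERO-FIBRE COMPLETENESS `hD_C` BY THE (α) MINI-TOWER — ASSEMBLY (ZERO-CERT §2; R166 (1))
(cell `qec`, experiment CDX; idea-1 g5; data `ETowerZeroMini345XD`, certificates `ETowerZeroMini345XZ`; engine = the landed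
`nodeK_sound` / `goodFibK_zero` / `base_sound` / `level_sound` / `kerK_doubleK_iff` and the `ETowerZeroBand` consumers)

★ `hDC (hMC) : ∀ c, c < 2 ^ nsK GC 5 → 2 * popc (nsK GC 5) c ≤ 10 → kerK col0 (nK GC 5) (doubleK GC 5 c) → c = 0 ∨ MatchedK GC.ls GC.ms 5 DC c`
— the hypothesis `hD` of `ETowerZero.goodFibK_zero` for step C of the main tower, for ANY top column function `col0` carrying the step-C
fibre-table identity `hMC : ∀ j < nsK GC 5, tab TFC 72 j = col0 (GC.emb j) ⊕ col0 (GC.partner (GC.emb j))` (the #345 identity module's).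

Chain: `kerK col0 (doubleK c) ↔ kerK (tab TFC 72) c` (`kerK_doubleK_iff`) → `kerK cu1 c` (decided LINK `linkC`: `cu1 j = selXor RL (TFC j)`)
→ the two-step unextended MINI-TOWER E(6,6)u —GB→ E(6,3)u —GA→ E(3,3)u at W′ = 5 (RowCompat `rcuB`/`rcuA`, QId `qu1x…qu3y`, node soundness of
`nodeBm`/`nodeAm`, mini zero fibres from `DpB`/`DpA` by `goodFibK_zero` + `zeroD_of_ZT` at h′ = 2, mini base = plain-kernel completeness of
`cu3` from the bucketed certificates `zb3_…` by `kerD_of_ZT` + the {4811} unit facts `unitsAm`) gives `MatchedK 6 6 5 (0 :: DC) c` for every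
weight-≤-5 kernel word of `cu1`; the rep `0` unwraps to `c = 0` (`popc_transWK`, `eq_zero_of_popc_eq_zero`).
No data, no `decide +kernel` beyond numeral identities; nothing here asserts a value of `d_circ`.
Geometry facts `zokA/zokB/zshapeA/zshapeB` are REUSED from the landed `ETowerZero345SoundX` (gate dedup; eng-1 g3); `mokC` stays here.
-/

set_option maxRecDepth 100000
set_option linter.unusedVariables false

namespace Summit.Ventures.QEC.CircuitDistance.ETower.Sec345X.Zeros

open Summit.Ventures.QEC.Census Summit.Ventures.QEC.Census.Fold Summit.Ventures.QEC.CircuitDistance.ETower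

/-! ## Geometry facts (the main tower's `GA = ⟨6,3,true⟩`, `GB = ⟨6,6,false⟩`, `GC = ⟨12,6,true⟩` on 5 blocks) -/

/-- level-C index facts `OKK GC 5`. -/
theorem mokC : OKK Sec345X.GC 5 := (OKK_iff GC 5).2 (by decide)

/-! ## The decided identities as Props -/

/-- RowCompat of mini step B′. -/
theorem hRuB : RowCompat Sec345X.GB 5 cu1 cu2 RuB := rowCompat_of_check rcuB
/-- RowCompat of mini step A′. -/
theorem hRuA : RowCompat Sec345X.GA 5 cu2 cu3 RuA := rowCompat_of_check rcuA
/-- kernel translation invariance of `cu1` (`nK GB 5 = 180`). -/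
theorem hKu1 : ∀ da db u, u < 2 ^ nK Sec345X.GB 5 → (kerK cu1 (nK Sec345X.GB 5) u ↔ kerK cu1 (nK Sec345X.GB 5) (transWK Sec345X.GB.l Sec345X.GB.m 5 da db u)) :=
  fun da db _ hu => kerK_transWK_iff (l := 6) (m := 6) (by decide) (by decide) (qId_of_check qu1x) (qId_of_check qu1y) da db hu
/-- kernel translation invariance of `cu2` (`nK GA 5 = 90`). -/
theorem hKu2 : ∀ da db u, u < 2 ^ nK Sec345X.GA 5 → (kerK cu2 (nK Sec345X.GA 5) u ↔ kerK cu2 (nK Sec345X.GA 5) (transWK Sec345X.GA.l Sec345X.GA.m 5 da db u)) :=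
  fun da db _ hu => kerK_transWK_iff (l := 6) (m := 3) (by decide) (by decide) (qId_of_check qu2x) (qId_of_check qu2y) da db hu
/-- kernel translation invariance of `cu3` (base, 45 slots). -/
theorem hKu3 : ∀ da db s, s < 2 ^ (5 * (3 * 3)) → (kerK cu3 (5 * (3 * 3)) s ↔ kerK cu3 (5 * (3 * 3)) (transWK 3 3 5 da db s)) :=
  fun da db _ hs => kerK_transWK_iff (l := 3) (m := 3) (by decide) (by decide) (qId_of_check qu3x) (qId_of_check qu3y) da db hs
/-- the mini fibre / partner tables are their defining expressions. -/
theorem hMu1 : ∀ j, j < nsK Sec345X.GB 5 → Mu1 j = cu1 (Sec345X.GB.emb j) ^^^ cu1 (Sec345X.GB.partner (Sec345X.GB.emb j)) := fun _ _ => rfl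
/-- see `hMu1`. -/
theorem hMpu1 : ∀ j, j < nsK Sec345X.GB 5 → Mpu1 j = cu1 (Sec345X.GB.partner (Sec345X.GB.emb j)) := fun _ _ => rfl
/-- see `hMu1`. -/
theorem hMu2 : ∀ j, j < nsK Sec345X.GA 5 → Mu2 j = cu2 (Sec345X.GA.emb j) ^^^ cu2 (Sec345X.GA.partner (Sec345X.GA.emb j)) := fun _ _ => rfl
/-- see `hMu1`. -/
theorem hMpu2 : ∀ j, j < nsK Sec345X.GA 5 → Mpu2 j = cu2 (Sec345X.GA.partner (Sec345X.GA.emb j)) := fun _ _ => rfl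

/-! ## The mini-tower predicates -/

/-- top predicate of the mini-tower: `0` or a translate of a `DC` rep, as `MatchedK` against `DC0 = 0 :: DC` (translation-closed). -/
def QTm (u : ℕ) : Prop := MatchedK 6 6 5 DC0 u
/-- fibre property of step B′ = the predicate certified by step A′. -/
def NBm : ℕ → Prop := GoodFibK GB 5 cu1 5 QTm

/-- `QTm` is closed under un-translating. -/
theorem hQTm : ∀ da db u, QTm (transWK Sec345X.GB.l Sec345X.GB.m 5 da db u) → QTm u :=
  fun da db u h => matchedK_of_matchedK_transWK (l := 6) (m := 6) (by decide) (by decide) h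
/-- `QTm 0` (rep `0`). -/
theorem hQTm0 : QTm 0 := ⟨0, List.mem_cons_self, 0, 0, by unfold transWK; exact lin_zero _ _ _⟩
/-- `NBm` is closed under un-translating (small torus of B′ = big torus of A′). -/
theorem hNBm : ∀ da db v, NBm (transWK Sec345X.GA.l Sec345X.GA.m 5 da db v) → NBm v :=
  fun da db v h => goodFibK_transWK_closed zshapeB zokB hKu1 hQTm da db v h

/-! ## Node soundness -/

/-- continuation `kCm` certifies `QTm`. -/
theorem hkCm : ∀ S : List ℕ, (∀ J ∈ S, J < nK Sec345X.GB 5) → S.length = popc (nK Sec345X.GB 5) (Fold.maskOf S) → kCm S = true → QTm (Fold.maskOf S) := by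
  intro S _ _ h
  unfold kCm at h
  exact matchedK_of_matchedM h
/-- `nodeBm` soundness. -/
theorem hkBm : ∀ S, (∀ j ∈ S, j < nsK Sec345X.GB 5) → nodeBm S = true → NBm (Fold.maskOf S) := by
  intro S hS h
  exact nodeK_sound zshapeB zokB (hKu1 GB.gen.1 GB.gen.2) hMu1 hMpu1 (hQTm GB.gen.1 GB.gen.2) (fun S' hS' hl h' => hkCm S' hS' hl h') hS h
/-- `nodeAm` soundness. -/
theorem hkAm : ∀ S, (∀ j ∈ S, j < nsK Sec345X.GA 5) → nodeAm S = true → GoodFibK Sec345X.GA 5 cu2 5 NBm (Fold.maskOf S) := by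
  intro S hS h
  exact nodeK_sound zshapeA zokA (hKu2 GA.gen.1 GA.gen.2) hMu2 hMpu2 (hNBm GA.gen.1 GA.gen.2) (fun S' hS' _ h' => hkBm S' hS' h') hS h

/-! ## Mini zero fibres (h′ = 2) -/

/-- step B′ certificates in the consumer's binder shape. -/
theorem hzmB : ∀ b, b < 5 → ∀ k, k < 2 →
    ZT Mu1 (matchedB Sec345X.GB.ls Sec345X.GB.ms 5 DpB) k 0 (Mu1 (b * (Sec345X.GB.ls * Sec345X.GB.ms))) (2 ^ (b * (Sec345X.GB.ls * Sec345X.GB.ms))) (b * (Sec345X.GB.ls * Sec345X.GB.ms) + 1) (nsK Sec345X.GB 5) := by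
  have e1 : GB.ls = 6 := by decide
  have e2 : GB.ms = 3 := by decide
  have e3 : nsK GB 5 = 90 := by decide
  rw [e1, e2, e3]
  intro b hb k hk
  interval_cases b <;> interval_cases k
  exacts [zl_ZT zmB_b0_k0, zl_ZT zmB_b0_k1, zl_ZT zmB_b1_k0, zl_ZT zmB_b1_k1, zl_ZT zmB_b2_k0, zl_ZT zmB_b2_k1,
    zl_ZT zmB_b3_k0, zl_ZT zmB_b3_k1, zl_ZT zmB_b4_k0, zl_ZT zmB_b4_k1]
/-- step B′: the D-list `DpB` is complete. -/
theorem hDmB : ∀ c, c < 2 ^ nsK Sec345X.GB 5 → 2 * popc (nsK Sec345X.GB 5) c ≤ 5 → kerK cu1 (nK Sec345X.GB 5) (doubleK Sec345X.GB 5 c) →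
    c = 0 ∨ MatchedK Sec345X.GB.ls Sec345X.GB.ms 5 DpB c :=
  zeroD_of_ZT zshapeB zokB (M := Mu1) hMu1 hKu1 (W := 5) (h := 2) (by norm_num) (fun _ hm => matchedK_of_matchedB hm) hzmB
/-- ★ mini zero fibre of step B′. -/
theorem hzeroBm : NBm 0 := by
  refine goodFibK_zero zshapeB zokB hKu1 hQTm hQTm0 DpB hDmB ?_
  intro c hc _
  simp [DpB] at hc

/-- step A′ certificates in the consumer's binder shape. -/
theorem hzmA : ∀ b, b < 5 → ∀ k, k < 2 →
    ZT Mu2 (matchedB Sec345X.GA.ls Sec345X.GA.ms 5 DpA) k 0 (Mu2 (b * (Sec345X.GA.ls * Sec345X.GA.ms))) (2 ^ (b * (Sec345X.GA.ls * Sec345X.GA.ms))) (b * (Sec345X.GA.ls * Sec345X.GA.ms) + 1) (nsK Sec345X.GA 5) := by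
  have e1 : GA.ls = 3 := by decide
  have e2 : GA.ms = 3 := by decide
  have e3 : nsK GA 5 = 45 := by decide
  rw [e1, e2, e3]
  intro b hb k hk
  interval_cases b <;> interval_cases k
  exacts [zl_ZT zmA_b0_k0, zl_ZT zmA_b0_k1, zl_ZT zmA_b1_k0, zl_ZT zmA_b1_k1, zl_ZT zmA_b2_k0, zl_ZT zmA_b2_k1,
    zl_ZT zmA_b3_k0, zl_ZT zmA_b3_k1, zl_ZT zmA_b4_k0, zl_ZT zmA_b4_k1]
/-- step A′: the D-list `DpA` is complete. -/
theorem hDmA : ∀ c, c < 2 ^ nsK Sec345X.GA 5 → 2 * popc (nsK Sec345X.GA 5) c ≤ 5 → kerK cu2 (nK Sec345X.GA 5) (doubleK Sec345X.GA 5 c) →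
    c = 0 ∨ MatchedK Sec345X.GA.ls Sec345X.GA.ms 5 DpA c :=
  zeroD_of_ZT zshapeA zokA (M := Mu2) hMu2 hKu2 (W := 5) (h := 2) (by norm_num) (fun _ hm => matchedK_of_matchedB hm) hzmA
/-- ★ mini zero fibre of step A′. -/
theorem hzeroAm : GoodFibK Sec345X.GA 5 cu2 5 NBm 0 := by
  refine goodFibK_zero zshapeA zokA hKu2 hNBm hzeroBm DpA hDmA ?_
  intro c hc _
  have hnode := (List.all_eq_true.1 hdpA_all) c hc
  have hlt : doubleK GA 5 c < 2 ^ 90 := lt_of_lt_of_eq (doubleK_lt zokA c) (by decide)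
  have h := hkBm (bitsOf 90 0 (doubleK GA 5 c)) (fun j hj => lt_of_lt_of_eq (lt_of_mem_bitsOf hj) (by decide)) hnode
  rwa [maskOf_bitsOf_zero _ _ hlt] at h

/-! ## Mini base and the two levels -/

/-- mini base certificates in the consumer's binder shape (plain table `cu3`, `k < 5`; item `(0,4)` from its two bands). -/
theorem hzb3 : ∀ b, b < 5 → ∀ k, k < 5 →
    ZT cu3 (matchedH 3 3 5 31 T3B) k 0 (cu3 (b * (3 * 3))) (2 ^ (b * (3 * 3))) (b * (3 * 3) + 1) (5 * (3 * 3)) := by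
  intro b hb k hk
  interval_cases b <;> interval_cases k
  exacts [zl_ZT zb3_b0_k0, zl_ZT zb3_b0_k1, zl_ZT zb3_b0_k2, zl_ZT zb3_b0_k3,
    ZT_of_bands (k := 3) covb3_b0_k4 (by
      intro p hp
      simp only [List.mem_cons, List.not_mem_nil, or_false] at hp
      rcases hp with rfl | rfl
      · exact zb3_b0_k4_i1_38
      · exact zb3_b0_k4_i38_45),
    zl_ZT zb3_b1_k0, zl_ZT zb3_b1_k1, zl_ZT zb3_b1_k2, zl_ZT zb3_b1_k3, zl_ZT zb3_b1_k4,
    zl_ZT zb3_b2_k0, zl_ZT zb3_b2_k1, zl_ZT zb3_b2_k2, zl_ZT zb3_b2_k3, zl_ZT zb3_b2_k4,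
    zl_ZT zb3_b3_k0, zl_ZT zb3_b3_k1, zl_ZT zb3_b3_k2, zl_ZT zb3_b3_k3, zl_ZT zb3_b3_k4,
    zl_ZT zb3_b4_k0, zl_ZT zb3_b4_k1, zl_ZT zb3_b4_k2, zl_ZT zb3_b4_k3, zl_ZT zb3_b4_k4]
/-- ★ MINI BASE: every weight-≤-5 kernel word of `cu3` is `0` or a translate of a `T3c` class. -/
theorem hbasem : ∀ s, s < 2 ^ nsK Sec345X.GA 5 → kerK cu3 (nsK Sec345X.GA 5) s → popc (nsK Sec345X.GA 5) s ≤ 5 → s = 0 ∨ MatchedK Sec345X.GA.ls Sec345X.GA.ms 5 T3c s := by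
  have e : nsK GA 5 = 5 * (3 * 3) := by decide
  rw [e]
  intro s hs hk hw
  exact kerD_of_ZT (l := 3) (m := 3) (nb := 5) (by decide) (by decide) (M := cu3)
    (fun da db u hu hku => (hKu3 da db u hu).1 hku) (h := 5) (D := T3c) (ok := matchedH 3 3 5 31 T3B)
    (fun _ hm => matchedK_of_matchedH hm) hzb3 s hs hw hk
/-- mini unit facts as fibre properties at the base numerals. -/
theorem hunitsm : ∀ t ∈ T3c, GoodFibK Sec345X.GA 5 cu2 5 NBm t := by
  intro t ht
  obtain ⟨hlt, hn⟩ := unitsAm t ht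
  have h := hkAm (bitsOf 45 0 t) (fun j hj => lt_of_lt_of_eq (lt_of_mem_bitsOf hj) (by decide)) hn
  rwa [maskOf_bitsOf_zero _ _ hlt] at h
/-- every weight-≤-5 kernel word of `cu3` has the A′-fibre property. -/
theorem smallAm : ∀ s, s < 2 ^ nsK Sec345X.GA 5 → kerK cu3 (nsK Sec345X.GA 5) s → popc (nsK Sec345X.GA 5) s ≤ 5 → GoodFibK Sec345X.GA 5 cu2 5 NBm s :=
  base_sound zshapeA zokA hKu2 hNBm hbasem hunitsm hzeroAm
/-- level A′: every weight-≤-5 kernel word of `cu2` satisfies `NBm`. -/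
theorem bigAm : ∀ u, u < 2 ^ nK Sec345X.GA 5 → kerK cu2 (nK Sec345X.GA 5) u → popc (nK Sec345X.GA 5) u ≤ 5 → NBm u := level_sound zokA hRuA smallAm
/-- the same, read on the small window of B′ (`nsK GB 5 = nK GA 5 = 90`). -/
theorem smallBm : ∀ s, s < 2 ^ nsK Sec345X.GB 5 → kerK cu2 (nsK Sec345X.GB 5) s → popc (nsK Sec345X.GB 5) s ≤ 5 → GoodFibK Sec345X.GB 5 cu1 5 QTm s := by
  have e : nsK GB 5 = nK GA 5 := by decide
  rw [e]; exact bigAm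
/-- ★ level B′: every weight-≤-5 kernel word of the UNEXTENDED level-C code `cu1` is `0` or a translate of a `DC` rep. -/
theorem bigBm : ∀ v, v < 2 ^ nK Sec345X.GB 5 → kerK cu1 (nK Sec345X.GB 5) v → popc (nK Sec345X.GB 5) v ≤ 5 → QTm v := level_sound zokB hRuB smallBm

/-! ## The link and the main-tower statement -/

/-- LINK as a Prop: the `cu1`-syndrome of a word on the 180 level-C slots is the `RL`-image of its `tab TFC 72`-syndrome. -/
theorem lin_cu1_eq (c : ℕ) : lin cu1 180 0 c = selXor RL (lin (tab Sec345X.TFC 72) 180 0 c) := by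
  have hj : ∀ j, j < 180 → cu1 (0 + j) = (fun J => selXor RL (tab TFC 72 J)) (0 + j) := by
    intro j hj
    have h := (List.all_eq_true.1 linkC) j (List.mem_range.2 hj)
    rw [Nat.zero_add]
    exact beq_iff_eq.1 h
  rw [lin_congr (g := cu1) (h := fun J => selXor RL (tab TFC 72 J)) (n := 180) (i0 := 0) hj c, map_lin_of_xor (selXor RL) (selXor_zero RL) (selXor_xor RL) (tab TFC 72) 180 c]

/-- ★★ **`hD_C` of the MAIN tower's level-C zero fibre** (the hypothesis `hD` of `goodFibK_zero` at step C; W = 10 ⇒ half-words of weight ≤ 5):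
for ANY top column function `col0` with the step-C fibre-table identity, every small word whose double lies in the top kernel is `0` or a
translate of a rep of the level-C D-list of record `DC`. -/
theorem hDC {col0 : ℕ → ℕ} (hMC : ∀ j, j < nsK Sec345X.GC 5 → tab Sec345X.TFC 72 j = col0 (Sec345X.GC.emb j) ^^^ col0 (Sec345X.GC.partner (Sec345X.GC.emb j))) :
    ∀ c, c < 2 ^ nsK Sec345X.GC 5 → 2 * popc (nsK Sec345X.GC 5) c ≤ 10 → kerK col0 (nK Sec345X.GC 5) (doubleK Sec345X.GC 5 c) →
      c = 0 ∨ MatchedK Sec345X.GC.ls Sec345X.GC.ms 5 Sec345X.Zeros.DC c := by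
  have eC : nsK GC 5 = 180 := by decide
  have eB : nK GB 5 = 180 := by decide
  intro c hc hw hker
  rw [kerK_doubleK_iff mokC hMC, eC] at hker
  rw [eC] at hc hw
  -- the unextended kernel
  have hk1 : kerK cu1 (nK GB 5) c := by
    rw [eB]
    unfold kerK at hker ⊢
    rw [lin_cu1_eq, hker, selXor_zero]
  have hQ : QTm c := bigBm c (by rw [eB]; exact hc) hk1 (by rw [eB]; omega)
  obtain ⟨t, ht, da, db, htr⟩ := hQ
  rcases List.mem_cons.1 ht with rfl | ht'
  · left
    have hp : popc (5 * (6 * 6)) c = 0 := by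
      rw [← popc_transWK (l := 6) (m := 6) (by decide) (by decide) 5 da db c, htr, popc_zero]
    exact eq_zero_of_popc_eq_zero (n := 5 * (6 * 6)) (lt_of_lt_of_eq hc (by decide)) hp
  · right
    exact ⟨t, ht', da, db, htr⟩

end Summit.Ventures.QEC.CircuitDistance.ETower.Sec345X.Zeros
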